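import Summits.BirchSwinnertonDyer.Rank1Residual.GaloisImage.ThreeAdicFrobeniusWitness
import HarnessLib

/-!
# `3`-adic TOWER surjectivity IN THE KERNEL for the six S0-KD-3 batch-1 curves of the lane's
# Kolyvagin derived-point engine (B-18 `KOLY-DERIV1@3`): `19107f1`, `6165g1`, `2601h1`, `5499e1`,
# `6867e1`, `15426e1` (cell `b2b-bsdres`, team n1011, seat p10 gen 2; tool = lit-kato gen 6's
# `GaloisImage/FrobeniusOrderWitness` + `GaloisImage/ThreeAdicFrobeniusWitness`)

HONEST FRAMING (cell `b2b-bsdres`, run/shared/lean/b2b/bsd-rank1-residual/, verbatim in every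
file): the goal of the cell is to DELETE the COMBINATION-SHAPED residual classes of the
Birch–Swinnerton-Dyer formula for ALL analytic-rank `≤ 1` elliptic curves over `ℚ` — "full BSD
formula for every rank `≤ 1` curve in class `C`" assembled STRICTLY from published theorems — so
that the rank-`≤ 1` remainder becomes exactly the CONSTRUCTION-SHAPED classes, which are TYPED
(missing-input `Prop`s), NOT attempted. This is not "finishing BSD". Team n1011 (N10/N11: X4 ∧
`p = 3`), seat p10: research route on the CONSTRUCTION-SHAPED class X4; prove what is provable now;
no claim beyond stated classes; census output = EVIDENCE / conjecture items, never a Literature fact;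
the label X4 is UNCHANGED; nothing is booked by this file.
Theorems only (no definition, no named fact); per-curve records, not a class theorem.

## What this file does

cc-eng-5's pre-registered S0-KD-3 batch 1 (`class-closure/eng-5/koly/step0/S0-KD-PREREG.md`, sha16
c0b9a63f) runs the Kolyvagin DERIVED-point certificate (McCallum 1991 §1 / Thm. 5.4; Matar–Nekovář
2019 §0.11) on six sha-2 V12-CLOSED rows of class X4 at `p = 3` (`r_an = 0`, `#Ш_an = 9`, additive at
`3` with `9 ∣ N`, `ρ̄_{E,3}` onto). The kernel consumer of such a certificate
(`Additive.card_sha_primary_eq_of_indexCertificate_of_matarNekovar`, p252487) carries McCallum's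
image hypothesis as the `3`-ADIC TOWER `∀ n, ρ̄_{E,3ⁿ}` onto (flag `McCallum91-padic-image`), which at
`p = 3` is NOT implied by surj(3) (Elkies 2006). This file discharges it IN THE KERNEL for the six
curves, exactly as lit-kato gen 6 did for the 35 RES-CERT rows (`ThreeAdicFrobeniusWitnessRecords1–6`):
for each Cremona label `<label>` and any globally minimal `W/ℚ` with that integral model,
* `surj3_v<label>` — `ρ̄_{E,3}` onto from TWO Frobenius witnesses read off kernel point counts
  (`ℓ₁`: `X² − a_{ℓ₁}X + ℓ₁` has no root mod `3`, i.e. `E[3]` irreducible; `ℓ₂ ≡ 1 (mod 3)` with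
  `a_{ℓ₂} ≡ 2 (mod 3)` and `9 ∤ #Ẽ(𝔽_{ℓ₂})`, i.e. a Frobenius of order `3` on `E[3]`;
  `hasSurjectiveModNGaloisRep_of_intModel_of_irr_of_order`);
* `towerSurj3_v<label>` — `ρ̄_{E,3ⁿ}` onto for every `n` from surj(3) and ONE Frobenius certificate
  `ℓ₃ ≡ 2, 5 (mod 9)`, `a_{ℓ₃} ≡ 3, 6 (mod 9)`
  (`forall_hasSurjectiveModNGaloisRep_three_pow_of_intModel_of_frobenius`).
The witness primes (all `≤ 67`, good: `ℓ ∤ Δ`) were found by a seat-local point count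
(`HOME/b2b-bsdres-n1011-p10/koly/witness_primes.py`, seconds); the kernel RECOUNTS every `#Ẽ(𝔽_ℓ)`
(`card_sol_eq_sum_euler`, `decide +kernel`). Census bits agreeing: sha-2 V12 `img = surj`, Cremona /
LMFDB galrep (no exceptional `3`-adic image on these labels). Consumers: the B-18 record files
`Additive/X4RankZeroKolyvaginRecordsThree*.lean` (this seat, on deposit of the engine's values).

References: [Serre1972] §2.4 Prop. 15; [SerreAbelianLadic1968] Ch. IV §3.4 Lemma 3; [Elkies2006]
Introduction, §1; [Kato2004Asterisque] (12.5.2) p. 222; [McCallumLMS1991] §1; Cremona's tables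
[Cremona2006] (`allcurves`).
-/

set_option autoImplicit false

noncomputable section

open scoped Classical

open WeierstrassCurve Literature.NumberTheory.EllipticCurves
  Summit.BirchSwinnertonDyer.BirchSwinnertonDyer.Rank1Residual.IntModel

namespace Summit.BirchSwinnertonDyer.Rank1Residual.GaloisImage

/-! ### `19107f1` (`N = 19107 = 3²·11·193`, additive at `3`, `r_an = 0`, `#Ш_an = 9`) -/

/-- `#Ẽ(𝔽_{5}) = 2` for Cremona's model `19107f1 = [0, 0, 1, -30693, -2069699]` (`a_{5} = 4`). [folklore] -/
theorem card_v19107f1_5 :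
    Nat.card (((⟨0, 0, 1, -30693, -2069699⟩ : WeierstrassCurve ℤ).map
      (Int.castRingHom (ZMod 5))).toAffine.Point) = 2 := by
  rw [@WeierstrassCurve.natCard_point_eq_one_add_card (ZMod 5) (@ZMod.instField 5 ⟨by norm_num⟩) _ _ _
    (by decide +kernel), @card_sol_eq_sum_euler (ZMod 5) (@ZMod.instField 5 ⟨by norm_num⟩) _ _
    (by rw [ZMod.ringChar_zmod_n]; decide), ZMod.card]
  decide +kernel

/-- `#Ẽ(𝔽_{37}) = 30` for Cremona's model `19107f1 = [0, 0, 1, -30693, -2069699]` (`a_{37} = 8`). [folklore] -/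
theorem card_v19107f1_37 :
    Nat.card (((⟨0, 0, 1, -30693, -2069699⟩ : WeierstrassCurve ℤ).map
      (Int.castRingHom (ZMod 37))).toAffine.Point) = 30 := by
  rw [@WeierstrassCurve.natCard_point_eq_one_add_card (ZMod 37) (@ZMod.instField 37 ⟨by norm_num⟩) _ _ _
    (by decide +kernel), @card_sol_eq_sum_euler (ZMod 37) (@ZMod.instField 37 ⟨by norm_num⟩) _ _
    (by rw [ZMod.ringChar_zmod_n]; decide), ZMod.card]
  decide +kernel

/-- `#Ẽ(𝔽_{41}) = 36` for Cremona's model `19107f1 = [0, 0, 1, -30693, -2069699]` (`a_{41} = 6`). [folklore] -/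
theorem card_v19107f1_41 :
    Nat.card (((⟨0, 0, 1, -30693, -2069699⟩ : WeierstrassCurve ℤ).map
      (Int.castRingHom (ZMod 41))).toAffine.Point) = 36 := by
  rw [@WeierstrassCurve.natCard_point_eq_one_add_card (ZMod 41) (@ZMod.instField 41 ⟨by norm_num⟩) _ _ _
    (by decide +kernel), @card_sol_eq_sum_euler (ZMod 41) (@ZMod.instField 41 ⟨by norm_num⟩) _ _
    (by rw [ZMod.ringChar_zmod_n]; decide), ZMod.card]
  decide +kernel

/-- **`ρ̄_{E,3}` onto for `19107f1`**, in the kernel: `ℓ₁ = 5` (`a_{5} = 4`: `X² − (4)X + 5`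
has no root mod `3`) and `ℓ₂ = 37` (`37 ≡ 1 (mod 3)`, `a_{37} = 8 ≡ 2 (mod 3)`, `#Ẽ(𝔽_{37}) = 30`,
`9 ∤ 30`: a Frobenius of order `3` on `E[3]`), for any globally minimal `W/ℚ` with this integral
model (census bit surj(3): sha-2 V12, Cremona galrep). [cite: Serre1972, §2.4 Prop. 15] -/
theorem surj3_v19107f1 {W : WeierstrassCurve ℚ} [W.IsElliptic] [W.IsGloballyMinimal]
    (hI : integralModelInt W = ⟨0, 0, 1, -30693, -2069699⟩) : W.HasSurjectiveModNGaloisRep 3 :=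
  @hasSurjectiveModNGaloisRep_of_intModel_of_irr_of_order W _ _ _ hI 3 ⟨by norm_num⟩ 5 37 ⟨by norm_num⟩
    ⟨by norm_num⟩ (by norm_num) (by norm_num) (by decide +kernel) (by decide +kernel) _ _
    card_v19107f1_5 card_v19107f1_37 (by decide) (by decide) (by decide) (by decide)

/-- **`ρ̄_{E,3ⁿ}` onto for every `n`, for `19107f1`** — the `3`-adic tower (Kato's (12.5.2) at `3`;
McCallum's image binder), in the kernel: surj(3) (`surj3_v19107f1`) and the Frobenius certificate
`ℓ = 41` (`41 ≡ 5 (mod 9)`, `#Ẽ(𝔽_{41}) = 36`, `a_{41} = 6 ≡ 6 (mod 9)`).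
[cite: SerreAbelianLadic1968, Ch. IV §3.4, Lemma 3 (IV-23)] [cite: Elkies2006, Introduction (p. 1) and §1] -/
theorem towerSurj3_v19107f1 {W : WeierstrassCurve ℚ} [W.IsElliptic] [W.IsGloballyMinimal]
    (hI : integralModelInt W = ⟨0, 0, 1, -30693, -2069699⟩) (n : ℕ) :
    W.HasSurjectiveModNGaloisRep (3 ^ n : ℕ) :=
  @forall_hasSurjectiveModNGaloisRep_three_pow_of_intModel_of_frobenius W _ _ _ hI (surj3_v19107f1 hI)
    41 ⟨by norm_num⟩ (by decide +kernel) _ card_v19107f1_41 (by decide) (by decide) n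


/-! ### `6165g1` (`N = 6165 = 3²·5·137`, additive at `3`, `r_an = 0`, `#Ш_an = 9`) -/

/-- `#Ẽ(𝔽_{11}) = 8` for Cremona's model `6165g1 = [1, -1, 1, -54257, -5478496]` (`a_{11} = 4`). [folklore] -/
theorem card_v6165g1_11 :
    Nat.card (((⟨1, -1, 1, -54257, -5478496⟩ : WeierstrassCurve ℤ).map
      (Int.castRingHom (ZMod 11))).toAffine.Point) = 8 := by
  rw [@WeierstrassCurve.natCard_point_eq_one_add_card (ZMod 11) (@ZMod.instField 11 ⟨by norm_num⟩) _ _ _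
    (by decide +kernel), @card_sol_eq_sum_euler (ZMod 11) (@ZMod.instField 11 ⟨by norm_num⟩) _ _
    (by rw [ZMod.ringChar_zmod_n]; decide), ZMod.card]
  decide +kernel

/-- `#Ẽ(𝔽_{31}) = 24` for Cremona's model `6165g1 = [1, -1, 1, -54257, -5478496]` (`a_{31} = 8`). [folklore] -/
theorem card_v6165g1_31 :
    Nat.card (((⟨1, -1, 1, -54257, -5478496⟩ : WeierstrassCurve ℤ).map
      (Int.castRingHom (ZMod 31))).toAffine.Point) = 24 := by
  rw [@WeierstrassCurve.natCard_point_eq_one_add_card (ZMod 31) (@ZMod.instField 31 ⟨by norm_num⟩) _ _ _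
    (by decide +kernel), @card_sol_eq_sum_euler (ZMod 31) (@ZMod.instField 31 ⟨by norm_num⟩) _ _
    (by rw [ZMod.ringChar_zmod_n]; decide), ZMod.card]
  decide +kernel

/-- `#Ẽ(𝔽_{59}) = 48` for Cremona's model `6165g1 = [1, -1, 1, -54257, -5478496]` (`a_{59} = 12`). [folklore] -/
theorem card_v6165g1_59 :
    Nat.card (((⟨1, -1, 1, -54257, -5478496⟩ : WeierstrassCurve ℤ).map
      (Int.castRingHom (ZMod 59))).toAffine.Point) = 48 := by
  rw [@WeierstrassCurve.natCard_point_eq_one_add_card (ZMod 59) (@ZMod.instField 59 ⟨by norm_num⟩) _ _ _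
    (by decide +kernel), @card_sol_eq_sum_euler (ZMod 59) (@ZMod.instField 59 ⟨by norm_num⟩) _ _
    (by rw [ZMod.ringChar_zmod_n]; decide), ZMod.card]
  decide +kernel

/-- **`ρ̄_{E,3}` onto for `6165g1`**, in the kernel: `ℓ₁ = 11` (`a_{11} = 4`: `X² − (4)X + 11`
has no root mod `3`) and `ℓ₂ = 31` (`31 ≡ 1 (mod 3)`, `a_{31} = 8 ≡ 2 (mod 3)`, `#Ẽ(𝔽_{31}) = 24`,
`9 ∤ 24`: a Frobenius of order `3` on `E[3]`), for any globally minimal `W/ℚ` with this integral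
model (census bit surj(3): sha-2 V12, Cremona galrep). [cite: Serre1972, §2.4 Prop. 15] -/
theorem surj3_v6165g1 {W : WeierstrassCurve ℚ} [W.IsElliptic] [W.IsGloballyMinimal]
    (hI : integralModelInt W = ⟨1, -1, 1, -54257, -5478496⟩) : W.HasSurjectiveModNGaloisRep 3 :=
  @hasSurjectiveModNGaloisRep_of_intModel_of_irr_of_order W _ _ _ hI 3 ⟨by norm_num⟩ 11 31 ⟨by norm_num⟩
    ⟨by norm_num⟩ (by norm_num) (by norm_num) (by decide +kernel) (by decide +kernel) _ _
    card_v6165g1_11 card_v6165g1_31 (by decide) (by decide) (by decide) (by decide)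

/-- **`ρ̄_{E,3ⁿ}` onto for every `n`, for `6165g1`** — the `3`-adic tower (Kato's (12.5.2) at `3`;
McCallum's image binder), in the kernel: surj(3) (`surj3_v6165g1`) and the Frobenius certificate
`ℓ = 59` (`59 ≡ 5 (mod 9)`, `#Ẽ(𝔽_{59}) = 48`, `a_{59} = 12 ≡ 3 (mod 9)`).
[cite: SerreAbelianLadic1968, Ch. IV §3.4, Lemma 3 (IV-23)] [cite: Elkies2006, Introduction (p. 1) and §1] -/
theorem towerSurj3_v6165g1 {W : WeierstrassCurve ℚ} [W.IsElliptic] [W.IsGloballyMinimal]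
    (hI : integralModelInt W = ⟨1, -1, 1, -54257, -5478496⟩) (n : ℕ) :
    W.HasSurjectiveModNGaloisRep (3 ^ n : ℕ) :=
  @forall_hasSurjectiveModNGaloisRep_three_pow_of_intModel_of_frobenius W _ _ _ hI (surj3_v6165g1 hI)
    59 ⟨by norm_num⟩ (by decide +kernel) _ card_v6165g1_59 (by decide) (by decide) n


/-! ### `2601h1` (`N = 2601 = 3²·17²`, additive at `3`, `r_an = 0`, `#Ш_an = 9`) -/

/-- `#Ẽ(𝔽_{11}) = 8` for Cremona's model `2601h1 = [1, -1, 0, -59877, -3934008]` (`a_{11} = 4`). [folklore] -/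
theorem card_v2601h1_11 :
    Nat.card (((⟨1, -1, 0, -59877, -3934008⟩ : WeierstrassCurve ℤ).map
      (Int.castRingHom (ZMod 11))).toAffine.Point) = 8 := by
  rw [@WeierstrassCurve.natCard_point_eq_one_add_card (ZMod 11) (@ZMod.instField 11 ⟨by norm_num⟩) _ _ _
    (by decide +kernel), @card_sol_eq_sum_euler (ZMod 11) (@ZMod.instField 11 ⟨by norm_num⟩) _ _
    (by rw [ZMod.ringChar_zmod_n]; decide), ZMod.card]
  decide +kernel

/-- `#Ẽ(𝔽_{13}) = 12` for Cremona's model `2601h1 = [1, -1, 0, -59877, -3934008]` (`a_{13} = 2`). [folklore] -/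
theorem card_v2601h1_13 :
    Nat.card (((⟨1, -1, 0, -59877, -3934008⟩ : WeierstrassCurve ℤ).map
      (Int.castRingHom (ZMod 13))).toAffine.Point) = 12 := by
  rw [@WeierstrassCurve.natCard_point_eq_one_add_card (ZMod 13) (@ZMod.instField 13 ⟨by norm_num⟩) _ _ _
    (by decide +kernel), @card_sol_eq_sum_euler (ZMod 13) (@ZMod.instField 13 ⟨by norm_num⟩) _ _
    (by rw [ZMod.ringChar_zmod_n]; decide), ZMod.card]
  decide +kernel

/-- `#Ẽ(𝔽_{59}) = 72` for Cremona's model `2601h1 = [1, -1, 0, -59877, -3934008]` (`a_{59} = -12`). [folklore] -/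
theorem card_v2601h1_59 :
    Nat.card (((⟨1, -1, 0, -59877, -3934008⟩ : WeierstrassCurve ℤ).map
      (Int.castRingHom (ZMod 59))).toAffine.Point) = 72 := by
  rw [@WeierstrassCurve.natCard_point_eq_one_add_card (ZMod 59) (@ZMod.instField 59 ⟨by norm_num⟩) _ _ _
    (by decide +kernel), @card_sol_eq_sum_euler (ZMod 59) (@ZMod.instField 59 ⟨by norm_num⟩) _ _
    (by rw [ZMod.ringChar_zmod_n]; decide), ZMod.card]
  decide +kernel

/-- **`ρ̄_{E,3}` onto for `2601h1`**, in the kernel: `ℓ₁ = 11` (`a_{11} = 4`: `X² − (4)X + 11`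
has no root mod `3`) and `ℓ₂ = 13` (`13 ≡ 1 (mod 3)`, `a_{13} = 2 ≡ 2 (mod 3)`, `#Ẽ(𝔽_{13}) = 12`,
`9 ∤ 12`: a Frobenius of order `3` on `E[3]`), for any globally minimal `W/ℚ` with this integral
model (census bit surj(3): sha-2 V12, Cremona galrep). [cite: Serre1972, §2.4 Prop. 15] -/
theorem surj3_v2601h1 {W : WeierstrassCurve ℚ} [W.IsElliptic] [W.IsGloballyMinimal]
    (hI : integralModelInt W = ⟨1, -1, 0, -59877, -3934008⟩) : W.HasSurjectiveModNGaloisRep 3 :=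
  @hasSurjectiveModNGaloisRep_of_intModel_of_irr_of_order W _ _ _ hI 3 ⟨by norm_num⟩ 11 13 ⟨by norm_num⟩
    ⟨by norm_num⟩ (by norm_num) (by norm_num) (by decide +kernel) (by decide +kernel) _ _
    card_v2601h1_11 card_v2601h1_13 (by decide) (by decide) (by decide) (by decide)

/-- **`ρ̄_{E,3ⁿ}` onto for every `n`, for `2601h1`** — the `3`-adic tower (Kato's (12.5.2) at `3`;
McCallum's image binder), in the kernel: surj(3) (`surj3_v2601h1`) and the Frobenius certificate
`ℓ = 59` (`59 ≡ 5 (mod 9)`, `#Ẽ(𝔽_{59}) = 72`, `a_{59} = -12 ≡ 6 (mod 9)`).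
[cite: SerreAbelianLadic1968, Ch. IV §3.4, Lemma 3 (IV-23)] [cite: Elkies2006, Introduction (p. 1) and §1] -/
theorem towerSurj3_v2601h1 {W : WeierstrassCurve ℚ} [W.IsElliptic] [W.IsGloballyMinimal]
    (hI : integralModelInt W = ⟨1, -1, 0, -59877, -3934008⟩) (n : ℕ) :
    W.HasSurjectiveModNGaloisRep (3 ^ n : ℕ) :=
  @forall_hasSurjectiveModNGaloisRep_three_pow_of_intModel_of_frobenius W _ _ _ hI (surj3_v2601h1 hI)
    59 ⟨by norm_num⟩ (by decide +kernel) _ card_v2601h1_59 (by decide) (by decide) n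


/-! ### `5499e1` (`N = 5499 = 3²·13·47`, additive at `3`, `r_an = 0`, `#Ш_an = 9`) -/

/-- `#Ẽ(𝔽_{11}) = 17` for Cremona's model `5499e1 = [1, -1, 0, -1695627, -849429158]` (`a_{11} = -5`). [folklore] -/
theorem card_v5499e1_11 :
    Nat.card (((⟨1, -1, 0, -1695627, -849429158⟩ : WeierstrassCurve ℤ).map
      (Int.castRingHom (ZMod 11))).toAffine.Point) = 17 := by
  rw [@WeierstrassCurve.natCard_point_eq_one_add_card (ZMod 11) (@ZMod.instField 11 ⟨by norm_num⟩) _ _ _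
    (by decide +kernel), @card_sol_eq_sum_euler (ZMod 11) (@ZMod.instField 11 ⟨by norm_num⟩) _ _
    (by rw [ZMod.ringChar_zmod_n]; decide), ZMod.card]
  decide +kernel

/-- `#Ẽ(𝔽_{67}) = 60` for Cremona's model `5499e1 = [1, -1, 0, -1695627, -849429158]` (`a_{67} = 8`). [folklore] -/
theorem card_v5499e1_67 :
    Nat.card (((⟨1, -1, 0, -1695627, -849429158⟩ : WeierstrassCurve ℤ).map
      (Int.castRingHom (ZMod 67))).toAffine.Point) = 60 := by
  rw [@WeierstrassCurve.natCard_point_eq_one_add_card (ZMod 67) (@ZMod.instField 67 ⟨by norm_num⟩) _ _ _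
    (by decide +kernel), @card_sol_eq_sum_euler (ZMod 67) (@ZMod.instField 67 ⟨by norm_num⟩) _ _
    (by rw [ZMod.ringChar_zmod_n]; decide), ZMod.card]
  decide +kernel

/-- `#Ẽ(𝔽_{23}) = 18` for Cremona's model `5499e1 = [1, -1, 0, -1695627, -849429158]` (`a_{23} = 6`). [folklore] -/
theorem card_v5499e1_23 :
    Nat.card (((⟨1, -1, 0, -1695627, -849429158⟩ : WeierstrassCurve ℤ).map
      (Int.castRingHom (ZMod 23))).toAffine.Point) = 18 := by
  rw [@WeierstrassCurve.natCard_point_eq_one_add_card (ZMod 23) (@ZMod.instField 23 ⟨by norm_num⟩) _ _ _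
    (by decide +kernel), @card_sol_eq_sum_euler (ZMod 23) (@ZMod.instField 23 ⟨by norm_num⟩) _ _
    (by rw [ZMod.ringChar_zmod_n]; decide), ZMod.card]
  decide +kernel

/-- **`ρ̄_{E,3}` onto for `5499e1`**, in the kernel: `ℓ₁ = 11` (`a_{11} = -5`: `X² − (-5)X + 11`
has no root mod `3`) and `ℓ₂ = 67` (`67 ≡ 1 (mod 3)`, `a_{67} = 8 ≡ 2 (mod 3)`, `#Ẽ(𝔽_{67}) = 60`,
`9 ∤ 60`: a Frobenius of order `3` on `E[3]`), for any globally minimal `W/ℚ` with this integral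
model (census bit surj(3): sha-2 V12, Cremona galrep). [cite: Serre1972, §2.4 Prop. 15] -/
theorem surj3_v5499e1 {W : WeierstrassCurve ℚ} [W.IsElliptic] [W.IsGloballyMinimal]
    (hI : integralModelInt W = ⟨1, -1, 0, -1695627, -849429158⟩) : W.HasSurjectiveModNGaloisRep 3 :=
  @hasSurjectiveModNGaloisRep_of_intModel_of_irr_of_order W _ _ _ hI 3 ⟨by norm_num⟩ 11 67 ⟨by norm_num⟩
    ⟨by norm_num⟩ (by norm_num) (by norm_num) (by decide +kernel) (by decide +kernel) _ _
    card_v5499e1_11 card_v5499e1_67 (by decide) (by decide) (by decide) (by decide)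

/-- **`ρ̄_{E,3ⁿ}` onto for every `n`, for `5499e1`** — the `3`-adic tower (Kato's (12.5.2) at `3`;
McCallum's image binder), in the kernel: surj(3) (`surj3_v5499e1`) and the Frobenius certificate
`ℓ = 23` (`23 ≡ 5 (mod 9)`, `#Ẽ(𝔽_{23}) = 18`, `a_{23} = 6 ≡ 6 (mod 9)`).
[cite: SerreAbelianLadic1968, Ch. IV §3.4, Lemma 3 (IV-23)] [cite: Elkies2006, Introduction (p. 1) and §1] -/
theorem towerSurj3_v5499e1 {W : WeierstrassCurve ℚ} [W.IsElliptic] [W.IsGloballyMinimal]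
    (hI : integralModelInt W = ⟨1, -1, 0, -1695627, -849429158⟩) (n : ℕ) :
    W.HasSurjectiveModNGaloisRep (3 ^ n : ℕ) :=
  @forall_hasSurjectiveModNGaloisRep_three_pow_of_intModel_of_frobenius W _ _ _ hI (surj3_v5499e1 hI)
    23 ⟨by norm_num⟩ (by decide +kernel) _ card_v5499e1_23 (by decide) (by decide) n


/-! ### `6867e1` (`N = 6867 = 3²·7·109`, additive at `3`, `r_an = 0`, `#Ш_an = 9`) -/

/-- `#Ẽ(𝔽_{5}) = 2` for Cremona's model `6867e1 = [0, 0, 1, -1623, -25169]` (`a_{5} = 4`). [folklore] -/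
theorem card_v6867e1_5 :
    Nat.card (((⟨0, 0, 1, -1623, -25169⟩ : WeierstrassCurve ℤ).map
      (Int.castRingHom (ZMod 5))).toAffine.Point) = 2 := by
  rw [@WeierstrassCurve.natCard_point_eq_one_add_card (ZMod 5) (@ZMod.instField 5 ⟨by norm_num⟩) _ _ _
    (by decide +kernel), @card_sol_eq_sum_euler (ZMod 5) (@ZMod.instField 5 ⟨by norm_num⟩) _ _
    (by rw [ZMod.ringChar_zmod_n]; decide), ZMod.card]
  decide +kernel

/-- `#Ẽ(𝔽_{61}) = 66` for Cremona's model `6867e1 = [0, 0, 1, -1623, -25169]` (`a_{61} = -4`). [folklore] -/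
theorem card_v6867e1_61 :
    Nat.card (((⟨0, 0, 1, -1623, -25169⟩ : WeierstrassCurve ℤ).map
      (Int.castRingHom (ZMod 61))).toAffine.Point) = 66 := by
  rw [@WeierstrassCurve.natCard_point_eq_one_add_card (ZMod 61) (@ZMod.instField 61 ⟨by norm_num⟩) _ _ _
    (by decide +kernel), @card_sol_eq_sum_euler (ZMod 61) (@ZMod.instField 61 ⟨by norm_num⟩) _ _
    (by rw [ZMod.ringChar_zmod_n]; decide), ZMod.card]
  decide +kernel

/-- `#Ẽ(𝔽_{23}) = 18` for Cremona's model `6867e1 = [0, 0, 1, -1623, -25169]` (`a_{23} = 6`). [folklore] -/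
theorem card_v6867e1_23 :
    Nat.card (((⟨0, 0, 1, -1623, -25169⟩ : WeierstrassCurve ℤ).map
      (Int.castRingHom (ZMod 23))).toAffine.Point) = 18 := by
  rw [@WeierstrassCurve.natCard_point_eq_one_add_card (ZMod 23) (@ZMod.instField 23 ⟨by norm_num⟩) _ _ _
    (by decide +kernel), @card_sol_eq_sum_euler (ZMod 23) (@ZMod.instField 23 ⟨by norm_num⟩) _ _
    (by rw [ZMod.ringChar_zmod_n]; decide), ZMod.card]
  decide +kernel

/-- **`ρ̄_{E,3}` onto for `6867e1`**, in the kernel: `ℓ₁ = 5` (`a_{5} = 4`: `X² − (4)X + 5`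
has no root mod `3`) and `ℓ₂ = 61` (`61 ≡ 1 (mod 3)`, `a_{61} = -4 ≡ 2 (mod 3)`, `#Ẽ(𝔽_{61}) = 66`,
`9 ∤ 66`: a Frobenius of order `3` on `E[3]`), for any globally minimal `W/ℚ` with this integral
model (census bit surj(3): sha-2 V12, Cremona galrep). [cite: Serre1972, §2.4 Prop. 15] -/
theorem surj3_v6867e1 {W : WeierstrassCurve ℚ} [W.IsElliptic] [W.IsGloballyMinimal]
    (hI : integralModelInt W = ⟨0, 0, 1, -1623, -25169⟩) : W.HasSurjectiveModNGaloisRep 3 :=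
  @hasSurjectiveModNGaloisRep_of_intModel_of_irr_of_order W _ _ _ hI 3 ⟨by norm_num⟩ 5 61 ⟨by norm_num⟩
    ⟨by norm_num⟩ (by norm_num) (by norm_num) (by decide +kernel) (by decide +kernel) _ _
    card_v6867e1_5 card_v6867e1_61 (by decide) (by decide) (by decide) (by decide)

/-- **`ρ̄_{E,3ⁿ}` onto for every `n`, for `6867e1`** — the `3`-adic tower (Kato's (12.5.2) at `3`;
McCallum's image binder), in the kernel: surj(3) (`surj3_v6867e1`) and the Frobenius certificate
`ℓ = 23` (`23 ≡ 5 (mod 9)`, `#Ẽ(𝔽_{23}) = 18`, `a_{23} = 6 ≡ 6 (mod 9)`).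
[cite: SerreAbelianLadic1968, Ch. IV §3.4, Lemma 3 (IV-23)] [cite: Elkies2006, Introduction (p. 1) and §1] -/
theorem towerSurj3_v6867e1 {W : WeierstrassCurve ℚ} [W.IsElliptic] [W.IsGloballyMinimal]
    (hI : integralModelInt W = ⟨0, 0, 1, -1623, -25169⟩) (n : ℕ) :
    W.HasSurjectiveModNGaloisRep (3 ^ n : ℕ) :=
  @forall_hasSurjectiveModNGaloisRep_three_pow_of_intModel_of_frobenius W _ _ _ hI (surj3_v6867e1 hI)
    23 ⟨by norm_num⟩ (by decide +kernel) _ card_v6867e1_23 (by decide) (by decide) n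


/-! ### `15426e1` (`N = 15426 = 2·3²·857`, additive at `3`, `r_an = 0`, `#Ш_an = 9`) -/

/-- `#Ẽ(𝔽_{5}) = 8` for Cremona's model `15426e1 = [1, -1, 0, -117333, -15440139]` (`a_{5} = -2`). [folklore] -/
theorem card_v15426e1_5 :
    Nat.card (((⟨1, -1, 0, -117333, -15440139⟩ : WeierstrassCurve ℤ).map
      (Int.castRingHom (ZMod 5))).toAffine.Point) = 8 := by
  rw [@WeierstrassCurve.natCard_point_eq_one_add_card (ZMod 5) (@ZMod.instField 5 ⟨by norm_num⟩) _ _ _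
    (by decide +kernel), @card_sol_eq_sum_euler (ZMod 5) (@ZMod.instField 5 ⟨by norm_num⟩) _ _
    (by rw [ZMod.ringChar_zmod_n]; decide), ZMod.card]
  decide +kernel

/-- `#Ẽ(𝔽_{31}) = 24` for Cremona's model `15426e1 = [1, -1, 0, -117333, -15440139]` (`a_{31} = 8`). [folklore] -/
theorem card_v15426e1_31 :
    Nat.card (((⟨1, -1, 0, -117333, -15440139⟩ : WeierstrassCurve ℤ).map
      (Int.castRingHom (ZMod 31))).toAffine.Point) = 24 := by
  rw [@WeierstrassCurve.natCard_point_eq_one_add_card (ZMod 31) (@ZMod.instField 31 ⟨by norm_num⟩) _ _ _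
    (by decide +kernel), @card_sol_eq_sum_euler (ZMod 31) (@ZMod.instField 31 ⟨by norm_num⟩) _ _
    (by rw [ZMod.ringChar_zmod_n]; decide), ZMod.card]
  decide +kernel

/-- `#Ẽ(𝔽_{29}) = 36` for Cremona's model `15426e1 = [1, -1, 0, -117333, -15440139]` (`a_{29} = -6`). [folklore] -/
theorem card_v15426e1_29 :
    Nat.card (((⟨1, -1, 0, -117333, -15440139⟩ : WeierstrassCurve ℤ).map
      (Int.castRingHom (ZMod 29))).toAffine.Point) = 36 := by
  rw [@WeierstrassCurve.natCard_point_eq_one_add_card (ZMod 29) (@ZMod.instField 29 ⟨by norm_num⟩) _ _ _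
    (by decide +kernel), @card_sol_eq_sum_euler (ZMod 29) (@ZMod.instField 29 ⟨by norm_num⟩) _ _
    (by rw [ZMod.ringChar_zmod_n]; decide), ZMod.card]
  decide +kernel

/-- **`ρ̄_{E,3}` onto for `15426e1`**, in the kernel: `ℓ₁ = 5` (`a_{5} = -2`: `X² − (-2)X + 5`
has no root mod `3`) and `ℓ₂ = 31` (`31 ≡ 1 (mod 3)`, `a_{31} = 8 ≡ 2 (mod 3)`, `#Ẽ(𝔽_{31}) = 24`,
`9 ∤ 24`: a Frobenius of order `3` on `E[3]`), for any globally minimal `W/ℚ` with this integral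
model (census bit surj(3): sha-2 V12, Cremona galrep). [cite: Serre1972, §2.4 Prop. 15] -/
theorem surj3_v15426e1 {W : WeierstrassCurve ℚ} [W.IsElliptic] [W.IsGloballyMinimal]
    (hI : integralModelInt W = ⟨1, -1, 0, -117333, -15440139⟩) : W.HasSurjectiveModNGaloisRep 3 :=
  @hasSurjectiveModNGaloisRep_of_intModel_of_irr_of_order W _ _ _ hI 3 ⟨by norm_num⟩ 5 31 ⟨by norm_num⟩
    ⟨by norm_num⟩ (by norm_num) (by norm_num) (by decide +kernel) (by decide +kernel) _ _
    card_v15426e1_5 card_v15426e1_31 (by decide) (by decide) (by decide) (by decide)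

/-- **`ρ̄_{E,3ⁿ}` onto for every `n`, for `15426e1`** — the `3`-adic tower (Kato's (12.5.2) at `3`;
McCallum's image binder), in the kernel: surj(3) (`surj3_v15426e1`) and the Frobenius certificate
`ℓ = 29` (`29 ≡ 2 (mod 9)`, `#Ẽ(𝔽_{29}) = 36`, `a_{29} = -6 ≡ 3 (mod 9)`).
[cite: SerreAbelianLadic1968, Ch. IV §3.4, Lemma 3 (IV-23)] [cite: Elkies2006, Introduction (p. 1) and §1] -/
theorem towerSurj3_v15426e1 {W : WeierstrassCurve ℚ} [W.IsElliptic] [W.IsGloballyMinimal]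
    (hI : integralModelInt W = ⟨1, -1, 0, -117333, -15440139⟩) (n : ℕ) :
    W.HasSurjectiveModNGaloisRep (3 ^ n : ℕ) :=
  @forall_hasSurjectiveModNGaloisRep_three_pow_of_intModel_of_frobenius W _ _ _ hI (surj3_v15426e1 hI)
    29 ⟨by norm_num⟩ (by decide +kernel) _ card_v15426e1_29 (by decide) (by decide) n


end Summit.BirchSwinnertonDyer.Rank1Residual.GaloisImage

end
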